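import Summits.NavierStokesRegularity.FluidComputer.RowSwitchWindow
import HarnessLib

/-!
# `RowSwitchStage`: the assembled STAGE hand-over of the row chain — old row's `MemberOn` record and
# start box ⇒ the new row's start-box hypothesis `hu0` (`pub-fluidc-bp3/R1-DESIGN.md` §10.6, layer B′)

HONEST FRAMING (cell `pub-fluidc`, blueprint seat bp3, gen 22): low prior, high value-of-information
experiment on Tao's machine paradigm; NOT a claim that NS blows up. Bookkeeping only: `switchStage_sound`
chains `RowSegment.row_end` / `RowCert.row_sound` (the old row's end boxes `u_{2^msub}`, `Ē` at the
switch time `T = T₀ + H`), the reference continuity `x̂'(0) = x̂(H)` of `swStageOK`, the window lemma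
`RowSwitchWindow.window_I` at the new member time `σ' = s'(T)` and the new row's lock
`y_{p'}(σ') = X0_{p'}` (its `MemberOn` record) into `RowSwitchSound.switchStage_hu0`.  Hypotheses
beyond the two `MemberOn` records (to be discharged from circuit semantics, layer R): the switch window
`[s(T) − Ds, s(T) + Ds]` lies in the trajectory's ODE domain, the window defect class
`|δF| ≤ max(DEL, DEL')` there, the re-timing is within the window `|s'(T) − s(T)| ≤ Ds`, and both rows
carry the same real gate data.

[cite: Tao2016AveragedNS, §5.5 Thm 5.3 (5.5)]
-/

namespace Summit.NavierStokesRegularity.FluidComputer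

open Literature.Analysis.FluidPDE.FluidComputer

namespace RowCheck

open DIVec ChainField Finset Real Set Matrix

namespace RowData

variable {r r' : RowData} {c : SwCert}

/-! ### The assembled stage hand-over -/

/-- **Stage hand-over soundness** (`swStageOK r r' c`; old row `r` with member data `m` on
`[T₀, T₀ + H]`, new row `r'` started at `T = T₀ + H` with member data `m'` of the SAME trajectory,
re-timed): if the old member satisfies `MemberOn` up to `T` from the start box `u`, the new member
satisfies `MemberOn` (which locks `y_{p'}(s'(T)) = X0_{p'}`), the switch window
`[s(T) − Ds, s(T) + Ds]` lies in the trajectory's ODE domain with the window defect class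
`|δF| ≤ max(DEL, DEL')`, and the re-timing is within the window, `|s'(T) − s(T)| ≤ Ds`, then the new
row's frame coordinates start in its box `u'` — the `hu0` hypothesis of `row_sound` / `segment_sound`
for the next stage. (Same real gate data on both rows.) [folklore] -/
theorem switchStage_sound (hs : swStageOK r r' c = true) (h : r.framesOK = true) (hl : r.lockOK = true)
    (h' : r'.framesOK = true) (G : r.GateOK) (G' : r'.GateOK) (hg : G'.g = G.g) (hΛ : G'.Λ = G.Λ)
    (T0 : ℝ) (m m' : MemberData) (hy : m'.y = m.y) (hok : r.rowPass = true) (henc : r.encOK = true)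
    (hmem : (toModel (canon h) G T0 m).MemberOn (T0 + r.Hq))
    (hu0 : ∀ i, |(toModel (canon h) G T0 m).z T0 i| ≤ r.ubR 0 i)
    {Ts' : ℝ} (hTs' : T0 + r.Hq ≤ Ts') (hmem' : (toModel (canon h') G' (T0 + r.Hq) m').MemberOn Ts')
    (hWD : Icc (m.s (T0 + r.Hq) - (c.Ds : ℝ) / 2 ^ r'.P) (m.s (T0 + r.Hq) + (c.Ds : ℝ) / 2 ^ r'.P) ⊆ m.D)
    (hδw : ∀ ξ ∈ Icc (m.s (T0 + r.Hq) - (c.Ds : ℝ) / 2 ^ r'.P) (m.s (T0 + r.Hq) + (c.Ds : ℝ) / 2 ^ r'.P),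
      ∀ a, |m.δF ξ a| ≤ ((max (r.DEL a) (r'.DEL a) : ℤ) : ℝ) / 2 ^ r'.P)
    (hσ : |m'.s (T0 + r.Hq) - m.s (T0 + r.Hq)| ≤ (c.Ds : ℝ) / 2 ^ r'.P) :
    ∀ i, |(toModel (canon h') G' (T0 + r.Hq) m').z (T0 + r.Hq) i| ≤ r'.ubR 0 i := by
  obtain ⟨hP, hx, -, -⟩ := swStageOK_parts hs
  have W := swStageOK_win hs
  set T := T0 + r.Hq with hT
  set R := toModel (canon h) G T0 m with hR
  have hH0 : (0 : ℝ) < r.Hq := Hq_pos hok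
  have hH : (r.Hq : ℝ) ≠ 0 := hH0.ne'
  -- the old row's end boxes
  have hz : ∀ i, |R.z T i| ≤ r.ubR (2 ^ r.msub) i :=
    row_end (canon h) G T0 m hok henc (canon_hrow h hl) hmem hu0
  obtain ⟨h1, -, -, -⟩ := row_sound (canon h) G T0 m hok henc (canon_hrow h hl) hmem (by linarith) le_rfl hu0
  have he : ∀ a, |R.e T a| ≤ r.EbarR a := h1 T ⟨by linarith, le_rfl⟩
  have hep : R.e T r.p = 0 := RowModel.e_phase hmem ⟨by change T0 ≤ T; linarith, le_rfl⟩
  -- reference continuity: `e(T) = y(σ) − X0`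
  have hee : ∀ a, m.y (m.s T) a - r'.X0R a = R.e T a := by
    intro a
    simp only [hR, RowModel.e, toModel, hT, add_sub_cancel_left, X0R]
    rw [xh_ratCast, ← hx a, evalQ_zero]
  have he' : ∀ a, |m.y (m.s T) a - r'.X0R a| ≤ (r.Eb a : ℝ) / 2 ^ r'.P := by
    intro a; rw [hee a, hP]; exact he a
  -- the ODE on the window (old member data; same real gate data)
  have hyD : ∀ ξ ∈ m.D, ∀ a, HasDerivAt (fun τ => m.y τ a) (F G'.g G'.Λ (m.y ξ) a + m.δF ξ a) ξ := by
    intro ξ hξ a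
    rw [hg, hΛ]
    exact hmem.hy ξ hξ a
  -- the window facts at σ' = s'(T)
  set σ' := m'.s T with hσ'
  have hσW : σ' ∈ Icc (m.s T - (c.Ds : ℝ) / 2 ^ r'.P) (m.s T + (c.Ds : ℝ) / 2 ^ r'.P) := by
    obtain ⟨h1, h2⟩ := abs_le.1 hσ
    exact ⟨by linarith, by linarith⟩
  have hI := window_I W G' hWD hyD hδw he' σ' hσW
  -- the new row's lock at T
  have hdp : m.y σ' r'.p = r'.X0R r'.p := by
    have hl' := hmem'.hlock T ⟨le_rfl, hTs'⟩
    simp only [toModel, sub_self, xh_zero, hy] at hl'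
    simpa [X0R] using hl'
  exact switchStage_hu0 hs h hl h' G G' T0 m m' hy hH hz he hep
    (fun a => m.y σ' a - m.y (m.s T) a - (σ' - m.s T) * F G'.g G'.Λ r'.X0R a) hI
    (fun a => by rw [← hee a]; ring) hdp

end RowData

end RowCheck

end Summit.NavierStokesRegularity.FluidComputer
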